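import Summits.BirchSwinnertonDyer.BirchSwinnertonDyer.Theorems.ByReductionTypeAtTwoSupersingularIwasawaTwistNoCotorsion
import Summits.BirchSwinnertonDyer.BirchSwinnertonDyer.Theorems.ByReductionTypeAtTwoSupersingularUniformFlatLine
import Summits.BirchSwinnertonDyer.Rank1Residual.Supersingular.BlindPointLever
import Literature.NumberTheory.EllipticCurves.Sprung2024.ChromaticSmallControlProofs
import HarnessLib

/-!
# Route `ByReductionTypeAtTwo` (rung K4), crux `SupersingularRankZeroAtTwo` (item stmt-BirchSwinnertonDyer-19097):
# K67-NF REDUCED — the blind coinvariants `Sel♭_∞/(γ+1)` of Sprung's `X♭(E/ℚ_∞)` at `2` VANISH as soon as `X♭` has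
# no non-zero finite `Λ`-submodule (the Kim shape at `2`)
# (seat `bsd-2adic-tower-1`, GEN 57, key «K67-NF KERNEL REDUCTION»; `--supports 19097`, helper; reduces slot 4
# `stub_NF : FlatBlindNoCotorsionAtTwo` of the registered line `Cruxes/SupersingularRankZeroAtTwo/Lines/odd_blind_package.lean`
# (v2.3 bf9a9ec1b9dc18d1 / v2.4 6b3a2105f6bed8e6) BY NAME to ONE statement NF♭ «`X♭` has no non-zero finite `Λ`-submodule»)

HONEST FRAMING (cell `bsd-2adic`, run/shared/lean/pub/bsd-2adic/): THEOREMS ONLY; no definition, no instance, no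
named fact, no `sorry`; pure Iwasawa-module algebra over the tree's Pontryagin-dual ♭ datum — nothing about
`L`-functions; NF♭ itself («Sprung's `X♭(E/ℚ_∞)` at `2` has no non-zero finite `Λ`-submodule», B. D. Kim's Thm. 3.14
shape, in print only for `±` at ODD `p`) is NOT proved here and NOT asserted: it is the HYPOTHESIS; nothing booked;
BSD is not proved by any of this.  PARTITION (D-0054): X5@2 good-ss r₀ block (generic-odd locus 486/757) × p = 2 —
types-the-object-of (slot 4 of the registered line is reduced to NF♭ by name); closes none; 19097 OPEN.
bears_on: K4 (route-BirchSwinnertonDyer-ByReductionTypeAtTwo item 19097).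

## What is proved

* ★★ `OddBlindNF.flatBlindNoCotorsionAtTwo_of_noFiniteSubmodule` — **the body of `OddBlindPackage.FlatBlindNoCotorsionAtTwo`
  (v2.4 l.321–345) VERBATIM with ONE extra hypothesis inserted after the torsion binder**, the Kim shape
  `(∀ N : Submodule (IwasawaAlgebra 2) D.X, Finite N → N = ⊥) →`: for every good-supersingular `W` at `2`,
  cyclotomic `(κ, γ)`, `v ∋ 2`, Honda–Sprung local data `(g, c)` (the four clauses of the uniform ♭ line, binders
  only), every ♭ dual Selmer datum `D` (f.g., torsion) WITHOUT non-zero finite `Λ`-submodule: if `Sel♭_∞[γ+1]` is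
  finite then `Sel♭_∞/(γ+1)` is trivial.  A `Theorems` file cannot import the `Cruxes/…/Lines` file, so the line's
  `def` is restated unfolded; with `FlatNoFiniteSubmoduleAtTwo := ‹the same binder block through the torsion binder›
  → ∀ N : Submodule (IwasawaAlgebra 2) D.X, Finite N → N = ⊥` the line derives
  `FlatNoFiniteSubmoduleAtTwo → FlatBlindNoCotorsionAtTwo` by a one-line `fun`/`exact` (scratch-checked by this seat).
* `OddBlindNF.noFiniteSubmodule_of_subsingleton_blindCoinvariants` — the converse, hypothesis-free:
  `Sel♭_∞/(γ+1) = 0` ⇒ `X♭` has no non-zero finite `Λ`-submodule (Greenberg's last step of Prop. 4.14 at the blind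
  character); and `OddBlindNF.noFiniteSubmodule_iff_subsingleton_blindCoinvariants` — GIVEN `Sel♭_∞[γ+1]` finite
  (which K67-CD supplies on the odd-twist half), NF♭ ⟺ K67-NF.

PROOF = the general dual-pair theorem `IwasawaTranslation.subsingleton_endCoinvariants_add_natCast_of_forall_finite_eq_bot`
(ANY `p`, any dual pair, `p ∣ n`; sibling file `…IwasawaTwistNoCotorsion`) at `p = n = 2` for the dual pair
`SharpFlatSelmerDualData.isDualPair` (`T ↔ conj_γ − 1`; Sprung 2024 chromatic control file):
`(conj_γ − 1) + 2 = conj_γ + 1`; inside: ss-1's twisted pair `isDualPair_twisted` (p797323), Greenberg's Lemma 4.2 (i)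
for it, `#X♭[T+2] = #Sel♭_∞/(γ+1)`, and «finite `Λ`-submodule ⇒ `⊥`» (the hypothesis).

References: R. Greenberg, LNM 1716 (1999), §4 Lemma 4.2, Prop. 4.14–4.15, pp. 105, 124 [cite: GreenbergLNM1716, §4 Lemma 4.2];
B. D. Kim, J. Aust. Math. Soc. 95 (2013) 189–200, Thm. 1.1 / 3.14 (odd p; shape only) [cite: BDKim2013, Thm. 3.14];
F. Sprung, J. Number Theory 132 (2012), Def. 7.11 [cite: Sprung2012, Def. 7.11].
-/

set_option autoImplicit false
-- the Theorems namespace of this sub repeats the summit name by design (D-0017 nested layout)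
set_option linter.dupNamespace false

noncomputable section

open scoped Classical MatrixGroups ModularForm NumberField
open NumberField IsDedekindDomain CongruenceSubgroup WeierstrassCurve Literature.NumberTheory.EllipticCurves
  Literature.NumberTheory.EllipticCurves.ModularForms Literature.NumberTheory.EllipticCurves.Sprung2017
  Literature.NumberTheory.EllipticCurves.Sprung2012
  Literature.NumberTheory.EllipticCurves.Rank1Residual Literature.NumberTheory.EllipticCurves.Rank1Residual.Typed
  Literature.NumberTheory.EllipticCurves.Kobayashi2003 Literature.NumberTheory.EllipticCurves.IwasawaDual
  Literature.NumberTheory.GaloisRepresentations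
  ZpExtension Summit.BirchSwinnertonDyer.Rank1Residual Summit.BirchSwinnertonDyer.Rank1Residual.Supersingular
  Summit.BirchSwinnertonDyer.Rank1Residual.Supersingular.BlindLever Summit.BirchSwinnertonDyer.Rank1Residual.X5.O1

namespace Summit.BirchSwinnertonDyer.BirchSwinnertonDyer.Theorems

namespace OddBlindNF

open IwasawaTranslation

/-- `(conj_γ − 1) + 2 = conj_γ + 1` in `End(Sel♭_∞)`: the twist of `ψ = conj_γ − 1` by `n = 2` is the blind
(order-2) character `γ ↦ −1`, `γ + 1 ↔ T + 2`. [folklore] -/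
theorem sub_one_add_two_eq_add_one {S : Type*} [AddCommGroup S] (φ : AddMonoid.End S) :
    φ - 1 + ((2 : ℕ) : AddMonoid.End S) = φ + 1 := by
  rw [Nat.cast_ofNat, sub_add_eq_add_sub, add_sub_assoc]
  norm_num

/-! ### K67-NF ⟸ NF♭ -/

/-- **★★ K67-NF `FlatBlindNoCotorsionAtTwo` FROM «`X♭` has no non-zero finite `Λ`-submodule» (Kim shape at `2`).**
Statement = the body of `OddBlindPackage.FlatBlindNoCotorsionAtTwo` (line `odd_blind_package` v2.4 l.321–345)
VERBATIM, with the single extra hypothesis `(∀ N : Submodule (IwasawaAlgebra 2) D.X, Finite N → N = ⊥) →` inserted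
after the torsion binder: for every ♭ dual Selmer datum `X♭` at `2` (f.g., torsion, no non-zero finite
`Λ`-submodule), if `Sel♭_∞[γ+1]` is finite then the `ψ₂`-coinvariants `Sel♭_∞/(γ+1)` are TRIVIAL (`X♭[T+2]` is a
finite `Λ`-submodule, hence `0`, and `#Sel♭_∞/(γ+1) = #X♭[T+2]`).  Proof: the any-`p` dual-pair theorem
`IwasawaTranslation.subsingleton_endCoinvariants_add_natCast_of_forall_finite_eq_bot` at `p = n = 2` for
`SharpFlatSelmerDualData.isDualPair`.  NF♭ is the hypothesis, not proved (in print only for `±` at odd `p`).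
[cite: GreenbergLNM1716, §4 Lemma 4.2, p. 124] [cite: BDKim2013, Thm. 3.14 (odd p; shape only)] -/
theorem flatBlindNoCotorsionAtTwo_of_noFiniteSubmodule :
  ∀ (W : WeierstrassCurve ℚ) [W.IsElliptic] [W.IsGloballyMinimal], GoodSS W 2 →
  ∀ (κ : ZpExtension ℚ 2) (γ : Field.absoluteGaloisGroup ℚ),
    κ.IsCyclotomic → κ.IsTopGenerator γ → IsCyclotomicVariable 2 γ →
  ∀ (v : HeightOneSpectrum (𝓞 ℚ)), (2 : 𝓞 ℚ) ∈ v.asIdeal →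
  ∀ (g : Field.absoluteGaloisGroup (v.adicCompletion ℚ)) (c : ℕ → localPoints W (v.adicCompletion ℚ)),
    κ.IsTopGenerator (resGalOfEmb (closureEmb (K := ℚ) (v.adicCompletion ℚ)) g) →
    (∀ n, c n ∈ localLayerPointsOfEmb κ (closureEmb (K := ℚ) (v.adicCompletion ℚ)) W n) →
    (∀ n, 1 ≤ n → localTraceOfEmb κ (closureEmb (K := ℚ) (v.adicCompletion ℚ)) W n (n + 1)
      (c (n + 1)) = W.frobeniusTrace 2 • c n - c (n - 1)) →
    (∀ z₀ : localLayerPointsOfEmb κ (closureEmb (K := ℚ) (v.adicCompletion ℚ)) W 0 →+ ℤ_[2],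
      evalOn W (localLayerPointsOfEmb κ (closureEmb (K := ℚ) (v.adicCompletion ℚ)) W 0) z₀ (c 0) = 0 →
        z₀ = 0) →
    (∀ a : ℤ_[2],
      (∃ z₀ : localLayerPointsOfEmb κ (closureEmb (K := ℚ) (v.adicCompletion ℚ)) W 0 →+ ℤ_[2],
        evalOn W (localLayerPointsOfEmb κ (closureEmb (K := ℚ) (v.adicCompletion ℚ)) W 0) z₀ (c 0) = 2 * a) →
      ∃ y : localLayerPointsOfEmb κ (closureEmb (K := ℚ) (v.adicCompletion ℚ)) W 0 →+ ℤ_[2],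
        evalOn W (localLayerPointsOfEmb κ (closureEmb (K := ℚ) (v.adicCompletion ℚ)) W 0) y (c 0) = a) →
  ∀ (D : SharpFlatSelmerDualData W κ γ (closureEmb (K := ℚ) (v.adicCompletion ℚ))
      (W.frobeniusTrace 2) g c .flat) [Module.Finite (IwasawaAlgebra 2) D.X],
    Module.IsTorsion (IwasawaAlgebra 2) D.X →
    (∀ N : Submodule (IwasawaAlgebra 2) D.X, Finite N → N = ⊥) →
    Finite (endInvariants (conjSharpFlatSelmerInfty W κ (closureEmb (K := ℚ) (v.adicCompletion ℚ))
      (W.frobeniusTrace 2) g c .flat γ + 1)) →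
    Subsingleton (EndCoinvariants (conjSharpFlatSelmerInfty W κ (closureEmb (K := ℚ) (v.adicCompletion ℚ))
      (W.frobeniusTrace 2) g c .flat γ + 1)) := by
  intro W _ _ _hss κ γ _hκ hγ _hγ' v _hv g c _hg _hc _htr _hz _hsat D _ htors hNF hfin
  -- the dual pair `T ↔ conj_γ - 1` of the ♭ datum, twisted by `n = p = 2`: `(conj_γ - 1) + 2 = conj_γ + 1`
  have key := subsingleton_endCoinvariants_add_natCast_of_forall_finite_eq_bot (D.isDualPair hγ) htors hNF
    (dvd_refl 2)
  rw [sub_one_add_two_eq_add_one] at key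
  exact key hfin

/-! ### The converse and the equivalence at the blind character -/

/-- **`Sel♭_∞/(γ+1) = 0` ⇒ `X♭` has no non-zero finite `Λ`-submodule** (hypothesis-free converse; Greenberg's last
step of the proof of Prop. 4.14 at the blind character: `X♭[T+2] = 0` and `T + 2 ∈ 𝔪_Λ`).
[cite: GreenbergLNM1716, §4 proof of Prop. 4.14 (p. 105), p. 117] -/
theorem noFiniteSubmodule_of_subsingleton_blindCoinvariants {W : WeierstrassCurve ℚ} [W.IsGloballyMinimal]
    {κ : ZpExtension ℚ 2} {γ : Field.absoluteGaloisGroup ℚ} (hγ : κ.IsTopGenerator γ) {v : HeightOneSpectrum (𝓞 ℚ)}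
    {g : Field.absoluteGaloisGroup (v.adicCompletion ℚ)} {c : ℕ → localPoints W (v.adicCompletion ℚ)}
    (D : SharpFlatSelmerDualData W κ γ (closureEmb (K := ℚ) (v.adicCompletion ℚ)) (W.frobeniusTrace 2) g c .flat)
    (hS : Subsingleton (EndCoinvariants (conjSharpFlatSelmerInfty W κ (closureEmb (K := ℚ) (v.adicCompletion ℚ))
      (W.frobeniusTrace 2) g c .flat γ + 1))) :
    ∀ N : Submodule (IwasawaAlgebra 2) D.X, Finite N → N = ⊥ := by
  rw [← sub_one_add_two_eq_add_one] at hS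
  exact forall_finite_eq_bot_of_subsingleton_endCoinvariants_add_natCast (D.isDualPair hγ) (dvd_refl 2) hS

/-- **GIVEN `Sel♭_∞[γ+1]` finite: NF♭ ⟺ K67-NF** — for a ♭ dual Selmer datum at `2` (f.g., torsion) with finite
blind anti-invariants, «`X♭` has no non-zero finite `Λ`-submodule» iff «`Sel♭_∞/(γ+1) = 0`».
[cite: GreenbergLNM1716, §4 Lemma 4.2, pp. 105, 124] -/
theorem noFiniteSubmodule_iff_subsingleton_blindCoinvariants {W : WeierstrassCurve ℚ} [W.IsGloballyMinimal]
    {κ : ZpExtension ℚ 2} {γ : Field.absoluteGaloisGroup ℚ} (hγ : κ.IsTopGenerator γ) {v : HeightOneSpectrum (𝓞 ℚ)}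
    {g : Field.absoluteGaloisGroup (v.adicCompletion ℚ)} {c : ℕ → localPoints W (v.adicCompletion ℚ)}
    (D : SharpFlatSelmerDualData W κ γ (closureEmb (K := ℚ) (v.adicCompletion ℚ)) (W.frobeniusTrace 2) g c .flat)
    [Module.Finite (IwasawaAlgebra 2) D.X] (htors : Module.IsTorsion (IwasawaAlgebra 2) D.X)
    (hfin : Finite (endInvariants (conjSharpFlatSelmerInfty W κ (closureEmb (K := ℚ) (v.adicCompletion ℚ))
      (W.frobeniusTrace 2) g c .flat γ + 1))) :
    (∀ N : Submodule (IwasawaAlgebra 2) D.X, Finite N → N = ⊥) ↔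
      Subsingleton (EndCoinvariants (conjSharpFlatSelmerInfty W κ (closureEmb (K := ℚ) (v.adicCompletion ℚ))
        (W.frobeniusTrace 2) g c .flat γ + 1)) := by
  rw [← sub_one_add_two_eq_add_one] at hfin ⊢
  exact forall_finite_eq_bot_iff_subsingleton_endCoinvariants_add_natCast (D.isDualPair hγ) htors (dvd_refl 2)
    hfin

/-- **`#Sel♭_∞/(γ+1) = #X♭[T+2]`** — the blind-character dictionary entry for the ♭ datum (any datum, no finiteness
hypothesis). [cite: GreenbergLNM1716, §1 p. 60] -/
theorem natCard_blindCoinvariants_eq {W : WeierstrassCurve ℚ} [W.IsGloballyMinimal]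
    {κ : ZpExtension ℚ 2} {γ : Field.absoluteGaloisGroup ℚ} (hγ : κ.IsTopGenerator γ) {v : HeightOneSpectrum (𝓞 ℚ)}
    {g : Field.absoluteGaloisGroup (v.adicCompletion ℚ)} {c : ℕ → localPoints W (v.adicCompletion ℚ)}
    (D : SharpFlatSelmerDualData W κ γ (closureEmb (K := ℚ) (v.adicCompletion ℚ)) (W.frobeniusTrace 2) g c .flat) :
    Nat.card (EndCoinvariants (conjSharpFlatSelmerInfty W κ (closureEmb (K := ℚ) (v.adicCompletion ℚ))
        (W.frobeniusTrace 2) g c .flat γ + 1)) =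
      Nat.card (Submodule.torsionBy (IwasawaAlgebra 2) D.X
        (PowerSeries.X + PowerSeries.C (2 : ℤ_[2]) : IwasawaAlgebra 2)) := by
  rw [← sub_one_add_two_eq_add_one, ← natCard_torsionBy_X_add_C_eq (D.isDualPair hγ) (dvd_refl 2), Nat.cast_ofNat]

end OddBlindNF

end Summit.BirchSwinnertonDyer.BirchSwinnertonDyer.Theorems

end
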